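/-
Copyright (c) 2026. All rights reserved.
Released under Apache 2.0 license as described in the file LICENSE.
Authors: abc-iut cell — seat abc-iut-w5-d053 (wave 5, gen 3; §4(iii) non-vacuity programme, NV-L4 row
`GalModuleData` of abc-iut-w5-d197's INHABITATION-CENSUS-L4-v1; riders `GalModuleData.Iso`, `ShellInvariants`).
-/
import Literature.AnabelianGeometry.AbsoluteAnabelian.LogFrobeniusPanalocalization
import Literature.AnabelianGeometry.AbsoluteAnabelian.LogShellVolumes
import Literature.AnabelianGeometry.AbsoluteAnabelian.LogShellsOfUnitLog
import Mathlib.NumberTheory.Padics.ProperSpace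
import HarnessLib

/-!
# Non-vacuity records for [AbsTopIII] Cor 5.10 (i)/(iii): `GalModuleData` (`S^Gal` with its log-volumes and log-shell)

S. Mochizuki, *Topics in absolute anabelian geometry III: global reconstruction algorithms* [MochizukiAbsTopIII2015],
Cor 5.10 (i) p. 147 ("`S^Gal`, the topological submodule of Galois-invariants … equipped with a well-defined
log-volume (respectively, well-defined radial and angular log-volumes) … the `•`-log-shell `ℐ ⊆ S^Gal`"),
Cor 5.10 (iii) p. 147 (compatibility with the panalocalization morphism), Def 5.4 (iii) p. 126 (the log-shell
`ℐ_k = (p*)⁻¹ · log(𝒪_k^×)`), Prop 5.7 (i)(ii) p. 137 (the log-volumes `μ^log_k`, radial/angular on `k ≅ ℂ`).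

abc-iut-w5-d197's kernel INHABITATION-CENSUS-L4-v1 (HOME/staging/w5/w5-d197/g2/census/, 04:2xZ) lists the
layer-L4 record `GalModuleData` (abc-iut-L4-t3, `LogFrobeniusPanalocalization.lean`) — the value type of the
Cor 5.10 (i) interface `ShellInvariants` and the subject of `Cor510Panalocalization` — with ZERO producers (and its
identification record `GalModuleData.Iso` likewise).  This PROOF-ONLY file (no `def` / `instance` / `structure`;
witnesses inside the theorem terms) records, with honest labels:

* GENUINE nonarchimedean witness (`GalModuleData.exists_nonarch`): for every prime `p` and every proper
  ultrametric normed `ℚ_p`-algebra field `k` (every finite extension of `ℚ_p`), `S^Gal := k` with BOTH log-volume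
  fields `:= μ^log_k` (abc-iut-L4-t3's `localLogVolume k`, Prop 5.7 (i); "at a nonarchimedean `v` the two
  log-volume fields coincide by convention") and `ℐ :=` the log-shell of the REAL `p`-adic logarithm
  (`logShell (PadicLogOnUnits.ofUnitLog p k)`, abc-iut-L3-t11's merge of abc-iut-S1's `unitLog`); recorded with it:
  `𝒪_k ⊆ ℐ` (Def 5.4 (iii)) and `μ^log(𝒪_k) = 0` (Prop 5.7 (i)(a) normalisation).  Closed instance at `k = ℚ_p`
  (`GalModuleData.exists_padic`, Borel σ-algebra chosen inside the proof).
* GENUINE archimedean witness (`GalModuleData.exists_arch`, every universe): `S^Gal := ℂ` (as `ULift ℂ`), radial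
  and angular log-volumes `:=` abc-iut-L4-t3's `ComplexVolume.radialLogVolume` / `angularLogVolume` (Prop 5.7
  (ii)), `ℐ :=` `ComplexLogShell.logShell = closedBall 0 π`; recorded with it: `μ^log(ℐ) = log π`
  (Cor 5.10 (iv)(d), abc-iut-L4-t3's `radialLogVolume_archLogShell`).
* `GalModuleData.Iso` is reflexive / symmetric / transitive at the `Nonempty` level (`Iso.nonempty_refl`,
  `Iso.nonempty_symm`, `Iso.nonempty_trans`) — the bookkeeping `Cor510Panalocalization` needs.
* `ShellInvariants L` is inhabited for EVERY log-Frobenius setting `L` by the CONSTANT assignment of the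
  archimedean witness (`ShellInvariants.nonempty_const`), and for constant invariants `Cor510Panalocalization P I I`
  HOLDS for every panalocalization `P` (`cor510Panalocalization_const`).  Honest label: DEGENERATE on the
  container side — a constant assignment ignores the `•`-shell-container `S`; the genuine `S ↦ S^Gal` needs the
  Galois-theater categories `𝒩⊞_v` evaluated on objects, which the interface `LogFrobeniusSetting` keeps abstract.

HONEST FRAMING: consistency / packaging facts about the cell's own interface records; the numerical content
(Haar log-volumes, the `p`-adic log-shell, `μ(ℐ_ℂ) = π`) is classical and was proved by the seats cited; nothing of
[AbsTopIII] Cor 5.10 beyond that is asserted; nothing here bears on the disputed [IUTchIII] Cor. 3.12.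
A witness is consistency evidence only; instantiated ≠ endorsed.
-/

set_option autoImplicit false

namespace Literature.AnabelianGeometry.AbsoluteAnabelian

open MeasureTheory Set Metric
open scoped Pointwise Real

universe u

namespace GalModuleData

/-! ### `GalModuleData.Iso`: reflexive, symmetric, transitive -/

/-- The identity identification of `S^Gal` with itself (log-volumes and log-shell carried identically).
[cite: MochizukiAbsTopIII2015, Cor 5.10 (iii) p. 147] -/
theorem Iso.nonempty_refl (A : GalModuleData.{u}) : Nonempty (GalModuleData.Iso A A) :=
  ⟨{ equiv := ContinuousAddEquiv.refl A.carrier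
     logVol_image := fun s => by
       change A.logVol (id '' s) = A.logVol s
       rw [Set.image_id]
     angLogVol_image := fun s => by
       change A.angLogVol (id '' s) = A.angLogVol s
       rw [Set.image_id]
     shell_image := by
       change id '' A.shell = A.shell
       rw [Set.image_id] }⟩

/-- Identifications of `S^Gal`-data can be inverted. [cite: MochizukiAbsTopIII2015, Cor 5.10 (iii) p. 147] -/
theorem Iso.nonempty_symm {A B : GalModuleData.{u}} (e : GalModuleData.Iso A B) :
    Nonempty (GalModuleData.Iso B A) := by
  have himg : ∀ s : Set B.carrier, e.equiv '' (e.equiv.symm '' s) = s := fun s => by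
    rw [Set.image_image]
    simp
  refine ⟨{ equiv := e.equiv.symm
            logVol_image := fun s => ?_
            angLogVol_image := fun s => ?_
            shell_image := ?_ }⟩
  · rw [← e.logVol_image (e.equiv.symm '' s), himg]
  · rw [← e.angLogVol_image (e.equiv.symm '' s), himg]
  · rw [← e.shell_image, Set.image_image]
    simp

/-- Identifications of `S^Gal`-data compose. [cite: MochizukiAbsTopIII2015, Cor 5.10 (iii) p. 147] -/
theorem Iso.nonempty_trans {A B C : GalModuleData.{u}} (e : GalModuleData.Iso A B) (f : GalModuleData.Iso B C) :
    Nonempty (GalModuleData.Iso A C) := by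
  have himg : ∀ s : Set A.carrier, (e.equiv.trans f.equiv) '' s = f.equiv '' (e.equiv '' s) := fun s => by
    rw [Set.image_image]
    rfl
  refine ⟨{ equiv := e.equiv.trans f.equiv
            logVol_image := fun s => ?_
            angLogVol_image := fun s => ?_
            shell_image := ?_ }⟩
  · rw [himg, f.logVol_image, e.logVol_image]
  · rw [himg, f.angLogVol_image, e.angLogVol_image]
  · rw [himg, e.shell_image, f.shell_image]

/-! ### The GENUINE nonarchimedean witness: `S^Gal = k`, `μ^log_k`, the `p`-adic log-shell -/

/-- **`S^Gal` at a nonarchimedean place, GENUINE**: for every prime `p` and every proper ultrametric normed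
`ℚ_p`-algebra field `k` (every finite extension of `ℚ_p`), the record `GalModuleData` is inhabited by
`carrier := k`, `logVol = angLogVol := μ^log_k` (Prop 5.7 (i): `log` of the Haar measure normalised by
`μ(𝒪_k) = 1`) and `shell := ℐ_k = (p*)⁻¹ · log_p(𝒪_k^×)` for the REAL `p`-adic logarithm; moreover `𝒪_k ⊆ ℐ_k`
(Def 5.4 (iii)) and `μ^log(𝒪_k) = 0`.  (Packaged through an identification `e : S^Gal ≃ₜ+ k`, here the
identity.) [cite: MochizukiAbsTopIII2015, Cor 5.10 (i) p. 147] -/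
theorem exists_nonarch (p : ℕ) [Fact p.Prime] (k : Type) [NontriviallyNormedField k] [NormedAlgebra ℚ_[p] k]
    [IsUltrametricDist k] [ProperSpace k] [MeasurableSpace k] [BorelSpace k] :
    ∃ (A : GalModuleData.{0}) (e : A.carrier ≃ₜ+ k),
      (∀ s, A.logVol s = localLogVolume k (e '' s)) ∧ (∀ s, A.angLogVol s = localLogVolume k (e '' s)) ∧
      e '' A.shell = logShell (PadicLogOnUnits.ofUnitLog p k) ∧
      e ⁻¹' closedBall (0 : k) 1 ⊆ A.shell ∧ A.logVol (e ⁻¹' closedBall (0 : k) 1) = 0 := by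
  refine ⟨{ carrier := k, logVol := localLogVolume k, angLogVol := localLogVolume k,
            shell := logShell (PadicLogOnUnits.ofUnitLog p k) }, ContinuousAddEquiv.refl k,
    fun s => ?_, fun s => ?_, ?_, ?_, ?_⟩
  · change localLogVolume k s = localLogVolume k (id '' s)
    rw [Set.image_id]
  · change localLogVolume k s = localLogVolume k (id '' s)
    rw [Set.image_id]
  · change id '' logShell (PadicLogOnUnits.ofUnitLog p k) = _
    rw [Set.image_id]
  · change id ⁻¹' closedBall (0 : k) 1 ⊆ logShell (PadicLogOnUnits.ofUnitLog p k)
    rw [Set.preimage_id]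
    exact closedBall_subset_logShell_ofUnitLog p k
  · change localLogVolume k (id ⁻¹' closedBall (0 : k) 1) = 0
    rw [Set.preimage_id, localLogVolume, localVolume_closedBall_one, Real.log_one]

/-- **Closed instance at `k = ℚ_p`** (Borel σ-algebra): `S^Gal := ℚ_p` with `μ^log_{ℚ_p}` and the log-shell of
`log_p`, containing `ℤ_p`. [cite: MochizukiAbsTopIII2015, Cor 5.10 (i) p. 147] -/
theorem exists_padic (p : ℕ) [Fact p.Prime] :
    ∃ (A : GalModuleData.{0}) (e : A.carrier ≃ₜ+ ℚ_[p]),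
      e '' A.shell = logShell (PadicLogOnUnits.ofUnitLog p ℚ_[p]) ∧ e ⁻¹' closedBall (0 : ℚ_[p]) 1 ⊆ A.shell ∧
      A.logVol (e ⁻¹' closedBall (0 : ℚ_[p]) 1) = 0 := by
  letI : MeasurableSpace ℚ_[p] := borel ℚ_[p]
  haveI : BorelSpace ℚ_[p] := ⟨rfl⟩
  obtain ⟨A, e, -, -, hsh, hO, hvol⟩ := exists_nonarch p ℚ_[p]
  exact ⟨A, e, hsh, hO, hvol⟩

/-! ### The GENUINE archimedean witness: `S^Gal = ℂ`, radial/angular log-volumes, `ℐ = closedBall 0 π` -/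

/-- **`S^Gal` at an archimedean place, GENUINE** (every universe, carrier `ULift ℂ ≅ ℂ`): `logVol :=` the radial
log-volume and `angLogVol :=` the angular log-volume of Prop 5.7 (ii), `shell := ℐ_ℂ = closedBall 0 π`
(Def 5.4 (v)); moreover `μ^log(ℐ_ℂ) = log π` and `μ̆^log(𝒪_ℂ^×) = log 2π` (Cor 5.10 (iv)(d), abc-iut-L4-t3's
`radialLogVolume_archLogShell` / `angularLogVolume_archUnits`, consumed BY NAME; the same consistency pair was
staged independently by abc-iut-L5-t10 g5). [cite: MochizukiAbsTopIII2015, Cor 5.10 (i) p. 147] -/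
theorem exists_arch :
    ∃ (A : GalModuleData.{u}) (e : A.carrier ≃ₜ+ ℂ),
      (∀ s, A.logVol s = ComplexVolume.radialLogVolume (e '' s)) ∧
      (∀ s, A.angLogVol s = ComplexVolume.angularLogVolume (e '' s)) ∧
      e '' A.shell = ComplexLogShell.logShell ∧ e '' A.shell = closedBall (0 : ℂ) π ∧
      A.logVol A.shell = ComplexLogShell.logShellRadialLogVolume ∧
      A.angLogVol (e ⁻¹' ComplexLogShell.units) = ComplexLogShell.unitsAngularLogVolume := by
  let e : ULift.{u} ℂ ≃ₜ+ ℂ :=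
    { AddEquiv.ulift with continuous_toFun := continuous_uliftDown, continuous_invFun := continuous_uliftUp }
  have hsh : e '' (e ⁻¹' ComplexLogShell.logShell) = ComplexLogShell.logShell :=
    Set.image_preimage_eq _ e.surjective
  refine ⟨{ carrier := ULift.{u} ℂ
            logVol := fun s => ComplexVolume.radialLogVolume (e '' s)
            angLogVol := fun s => ComplexVolume.angularLogVolume (e '' s)
            shell := e ⁻¹' ComplexLogShell.logShell }, e, fun _ => rfl, fun _ => rfl, hsh, ?_, ?_, ?_⟩
  · rw [← ComplexLogShell.logShell_eq_closedBall]
    exact hsh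
  · change ComplexVolume.radialLogVolume (e '' (e ⁻¹' ComplexLogShell.logShell)) = _
    rw [hsh, radialLogVolume_archLogShell]
  · change ComplexVolume.angularLogVolume (e '' (e ⁻¹' ComplexLogShell.units)) = _
    rw [Set.image_preimage_eq _ e.surjective, angularLogVolume_archUnits]

/-- `GalModuleData` is inhabited in every universe (by the archimedean witness).
[cite: MochizukiAbsTopIII2015, Cor 5.10 (i) p. 147] -/
theorem nonempty : Nonempty GalModuleData.{u} :=
  let ⟨A, _⟩ := exists_arch.{u}
  ⟨A⟩

end GalModuleData

/-! ### Cor 5.10 (i)/(iii): `ShellInvariants` and `Cor510Panalocalization` for constant invariants -/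

variable {Vmod : Type u} {isArc : Vmod → Bool}

/-- **`ShellInvariants L` is inhabited for every log-Frobenius setting `L`**: the CONSTANT assignment of one
`S^Gal`-datum (here the archimedean witness) to every `•`-shell-container at every `v`.  Honest label:
DEGENERATE on the container side — it ignores `S`; the genuine `S ↦ S^Gal` requires evaluating the Galois-theater
categories on objects, which the interface keeps abstract. [cite: MochizukiAbsTopIII2015, Cor 5.10 (i) p. 147] -/
theorem ShellInvariants.nonempty_const (L : LogFrobeniusSetting Vmod isArc) : Nonempty (ShellInvariants L) :=
  let ⟨A, _⟩ := GalModuleData.exists_arch.{u}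
  ⟨fun _ _ => A⟩

/-- **Cor 5.10 (iii) for constant invariants**: if both settings carry the SAME constant `S^Gal`-assignment `A`,
the typed form of "The log-volumes of (i), as well as the construction of the `•`-log-shells from the various
shell-homotopies, are compatible with the panalocalization morphism `D⊚ → D✠` of Corollary 5.5, (vi)"
(`Cor510Panalocalization`) holds for EVERY panalocalization `P` (the identification is the identity of `A`).
Honest label: the typed assertion quantifies over abstract invariants; this records that it is satisfiable,
not that the genuine invariants satisfy it. [cite: MochizukiAbsTopIII2015, Cor 5.10 (iii) p. 147] -/
theorem cor510Panalocalization_const {L₁ L₂ : LogFrobeniusSetting Vmod isArc} (P : Panalocalization L₁ L₂)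
    (A : GalModuleData.{u}) : Cor510Panalocalization P (fun _ _ => A) (fun _ _ => A) :=
  fun _ _ => GalModuleData.Iso.nonempty_refl A

/-- … hence for every pair of settings and every panalocalization there ARE shell-invariants on both sides for which
Cor 5.10 (iii)'s typed conclusion holds. [cite: MochizukiAbsTopIII2015, Cor 5.10 (iii) p. 147] -/
theorem exists_shellInvariants_cor510Panalocalization {L₁ L₂ : LogFrobeniusSetting Vmod isArc}
    (P : Panalocalization L₁ L₂) :
    ∃ (I₁ : ShellInvariants L₁) (I₂ : ShellInvariants L₂), Cor510Panalocalization P I₁ I₂ :=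
  let ⟨A, _⟩ := GalModuleData.exists_arch.{u}
  ⟨fun _ _ => A, fun _ _ => A, cor510Panalocalization_const P A⟩

end Literature.AnabelianGeometry.AbsoluteAnabelian
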